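import Summits.CriticalPhenomena.CardyFormulaZ2.Theorems.CardyComplexConeParafermionToSLESixFamiliesDiamondDefsR5
import Summits.CriticalPhenomena.CardyFormulaZ2.Theorems.CardyComplexConeParafermionToSLESixFamiliesDiamondCollarWalk
import Summits.CriticalPhenomena.CardyFormulaZ2.Theorems.CardyComplexConeParafermionToSLESixFamiliesDiamondTraceCellGap
import HarnessLib

/-!
# The collar of line `potential-darboux-picard-diamond`: `UniformInnerEnvelope → ClosedCollar` (S3 (a), conditional)

Crux `ParafermionToSLESixFamilies` (stmt-CriticalPhenomena-11389), line `potential-darboux-picard-diamond`, registered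
CONDITIONAL helper `collar_of_uniformInnerEnvelope` of the stub S3 `ClosedPrecompactness`, conjunct (a) `ClosedCollar`
(`…DiamondDefsR5`): asymptotic equicontinuity of the renormalised face potential `δ^{2/3}Ψ` over exact pairs on the cells
of the CLOSED marked diamond along every admissible family, from 11387's milestone X1 `UniformInnerEnvelope`
(`‖cornerObs E E.δ v f‖ ≤ C R^{-1/3}` at lattice depth `R ≥ 1`; OPEN — a hypothesis here).

Proof (all lattice inputs landed): for small `δ` the discrete domain of the diamond is its full lattice box
(`eventually_mem_meshDomain_of_isMarkedDiamond`, `diamondCollar_box`) and its discrete boundary the two-layer frame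
(`diamondArcs_zdBoundary_iff_frame`), so every cell has a corner of lattice depth `≥ 2`, and two cells with centres `< η`
apart have such corners within `N = ⌈η/δ⌉ + 2` of each other in each coordinate (`Collar.abs_sub_le_of_dist_ctr`). Between
them the exact pair's site potential changes by `≤ 10 C₁ (3N+1)^{2/3}` (`diamondCollar_walk`, fed by the depth form
`obsBound_of_uniformInnerEnvelope` of the envelope — the box being `≥ 16N + 4` wide once `η ≤ min(α,β)/16`, `δ ≤ min(α,β)/30`,
`Collar.box_large`), the two cell–corner increments cost `≤ 1` each (`norm_cornerObs_le_one`), and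
`δ^{2/3}(2 + 10 C₁ (3N+1)^{2/3}) ≤ 2δ^{2/3} + 10 C₁ (13η)^{2/3} ≤ ε` by the choice of `η` (`Collar.exists_eta`) and of `δ`.
Nothing cited.
-/

noncomputable section

namespace Summit.CriticalPhenomena.CardyFormulaZ2.Cruxes.ParafermionToSLESixFamilies.PotentialDarbouxPicardDiamond

open scoped Topology BigOperators
open Filter Set Metric Complex
open Literature.Probability Literature.Probability.LatticeModels Literature.Probability.Percolation
open Literature.Probability.LatticeModels.DiscreteDobrushin
open Literature.Probability.RandomPlanarGeometry
open Summit.CriticalPhenomena.CardyFormulaZ2.Cruxes.EdgePrecompact.QkzStripBoundaryArm (cornerObs UniformInnerEnvelope)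
open Summit.CriticalPhenomena.CardyFormulaZ2.Cruxes.ParafermionToSLESixFamilies.IicTraceFluxPairing (IsFamily)

namespace Collar

/-- **Choice of the modulus `η`**: a positive `η ≤ min(α, β)/16` with `10 C₁ (13 η)^{2/3} ≤ ε/2`. -/
theorem exists_eta {C₁ α β ε : ℝ} (hα : 0 < α) (hβ : 0 < β) (hε : 0 < ε) :
    ∃ η : ℝ, 0 < η ∧ η ≤ α / 16 ∧ η ≤ β / 16 ∧ 10 * C₁ * (13 * η) ^ ((2:ℝ) / 3) ≤ ε / 2 := by
  have hc : ContinuousAt (fun t : ℝ => 10 * C₁ * (13 * t) ^ ((2:ℝ) / 3)) 0 :=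
    continuousAt_const.mul (((continuous_const.mul continuous_id).rpow_const fun _ => Or.inr (by norm_num)).continuousAt)
  have h0 : (fun t : ℝ => 10 * C₁ * (13 * t) ^ ((2:ℝ) / 3)) 0 < ε / 2 := by
    simp only [mul_zero, Real.zero_rpow (by norm_num : ((2:ℝ) / 3) ≠ 0)]
    linarith
  have ev1 : ∀ᶠ t in 𝓝[>] (0:ℝ), 10 * C₁ * (13 * t) ^ ((2:ℝ) / 3) < ε / 2 :=
    eventually_nhdsWithin_of_eventually_nhds (hc.eventually (eventually_lt_nhds h0))
  have ev2 : ∀ᶠ t in 𝓝[>] (0:ℝ), t ∈ Ioo (0:ℝ) (min (α / 16) (β / 16)) := Ioo_mem_nhdsGT (by positivity)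
  obtain ⟨t, ht1, ht2⟩ := (ev1.and ev2).exists
  exact ⟨t, ht2.1, ht2.2.le.trans (min_le_left _ _), ht2.2.le.trans (min_le_right _ _), ht1.le⟩

/-- Eventually `2 δ^{2/3} ≤ ε/2`. -/
theorem eventually_two_mul_rpow_le {ε : ℝ} (hε : 0 < ε) : ∀ᶠ δ in 𝓝[>] (0:ℝ), 2 * δ ^ ((2:ℝ) / 3) ≤ ε / 2 := by
  have hc : ContinuousAt (fun t : ℝ => 2 * t ^ ((2:ℝ) / 3)) 0 :=
    continuousAt_const.mul (Real.continuousAt_rpow_const _ _ (Or.inr (by norm_num)))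
  have h0 : (fun t : ℝ => 2 * t ^ ((2:ℝ) / 3)) 0 < ε / 2 := by
    simp only [Real.zero_rpow (by norm_num : ((2:ℝ) / 3) ≠ 0), mul_zero]
    linarith
  exact (eventually_nhdsWithin_of_eventually_nhds (hc.eventually (eventually_lt_nhds h0))).mono fun _ h => h.le

/-- **The box is large compared with the chain**: `16 N + 4 ≤ q − p` once `δ N ≤ η + 3δ`, `η ≤ γ/16`, `δ ≤ γ/30` and
`δ (q − p) + 2δ ≥ 2√2 γ`. -/
theorem box_large {δ η γ : ℝ} {N : ℕ} {p q : ℤ} (hδ : 0 < δ) (hN : δ * N ≤ η + 3 * δ) (hη : η ≤ γ / 16)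
    (hδγ : δ ≤ γ / 30) (hw : 2 * Real.sqrt 2 * γ ≤ δ * (q - p) + 2 * δ) : 16 * (N : ℤ) + 4 ≤ q - p := by
  have hs : (1.4 : ℝ) ≤ Real.sqrt 2 := by
    rw [Real.le_sqrt (by norm_num) (by norm_num)]; norm_num
  have hγ : 0 ≤ γ := by linarith
  have h1 : δ * (16 * (N : ℝ) + 4) ≤ δ * ((q : ℝ) - p) := by nlinarith
  have h2 : 16 * (N : ℝ) + 4 ≤ (q : ℝ) - p := le_of_mul_le_mul_left h1 hδ
  exact_mod_cast h2

/-- **Close cells have close interior corners**: `dist(ctr f, ctr f′) < η` and `η + 2δ ≤ δ N` give `|v′ᵢ − vᵢ| ≤ N` for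
corners `v ∈ f`, `v′ ∈ f′`. -/
theorem abs_sub_le_of_dist_ctr {δ η : ℝ} {N : ℕ} (hδ : 0 < δ) (hN : η + 2 * δ ≤ δ * N) {v f v' f' : Site 2}
    (hv : IsCorner v f) (hv' : IsCorner v' f') (hdist : dist (ctr δ f) (ctr δ f') < η) :
    |v' 0 - v 0| ≤ (N : ℤ) ∧ |v' 1 - v 1| ≤ (N : ℤ) := by
  have d1 := norm_corner_sub_ctr_le hδ.le hv
  have d2 := norm_corner_sub_ctr_le hδ.le hv'
  rw [dist_eq_norm] at hdist
  have hs2lt : Real.sqrt 2 / 2 < 1 := by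
    rw [div_lt_one two_pos, Real.sqrt_lt' two_pos]; norm_num
  have hhδ : Real.sqrt 2 / 2 * δ < δ := by nlinarith
  have key : ‖meshPoint δ v' - meshPoint δ v‖ < δ * N := by
    have e : meshPoint δ v' - meshPoint δ v =
        (meshPoint δ v' - ctr δ f') - (meshPoint δ v - ctr δ f) - (ctr δ f - ctr δ f') := by ring
    have t1 := norm_sub_le ((meshPoint δ v' - ctr δ f') - (meshPoint δ v - ctr δ f)) (ctr δ f - ctr δ f')
    have t2 := norm_sub_le (meshPoint δ v' - ctr δ f') (meshPoint δ v - ctr δ f)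
    rw [e]
    linarith
  have hre := (abs_re_le_norm (meshPoint δ v' - meshPoint δ v)).trans_lt key
  have him := (abs_im_le_norm (meshPoint δ v' - meshPoint δ v)).trans_lt key
  rw [sub_re, meshPoint_re, meshPoint_re, ← mul_sub, abs_mul, abs_of_pos hδ] at hre
  rw [sub_im, meshPoint_im, meshPoint_im, ← mul_sub, abs_mul, abs_of_pos hδ] at him
  have hre' : |((v' 0 - v 0 : ℤ) : ℝ)| ≤ N := by push_cast; exact (lt_of_mul_lt_mul_left hre hδ.le).le
  have him' : |((v' 1 - v 1 : ℤ) : ℝ)| ≤ N := by push_cast; exact (lt_of_mul_lt_mul_left him hδ.le).le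
  rw [← Int.cast_abs] at hre' him'
  exact ⟨by exact_mod_cast hre', by exact_mod_cast him'⟩

end Collar

open Collar

/-- **S3 (a), conditionally: `UniformInnerEnvelope → ClosedCollar`.** Along an admissible family of a marked diamond, for
small `δ` the discrete domain is the full lattice box of the diamond (`eventually_mem_meshDomain_of_isMarkedDiamond`,
`diamondCollar_box`), its discrete boundary the two-layer frame (`diamondArcs_zdBoundary_iff_frame`), so a cell has a
corner of lattice depth `≥ 2` and two cells with centres `< η` apart have such corners within `N = ⌈η/δ⌉ + 2` of each
other. The exact pair's site potential changes by `≤ 10 C₁ (3N+1)^{2/3}` between them (`diamondCollar_walk`, fed by the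
depth form `obsBound_of_uniformInnerEnvelope` of the envelope), the two cell–corner increments cost `≤ 1` each, and
`δ^{2/3}(2 + 10 C₁ (3N+1)^{2/3}) ≤ 2δ^{2/3} + 10 C₁ (13η)^{2/3} ≤ ε`. -/
theorem collar_of_uniformInnerEnvelope : Summit.CriticalPhenomena.CardyFormulaZ2.Cruxes.EdgePrecompact.QkzStripBoundaryArm.UniformInnerEnvelope → ClosedCollar := by
  intro hU D hD Λ hΛ ε hε
  obtain ⟨C₁, hC₁, hobs0⟩ := obsBound_of_uniformInnerEnvelope hU
  have hgoodev := eventually_mem_meshDomain_of_isMarkedDiamond D hD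
  obtain ⟨c, α, β, hα, hβ, hcar⟩ := hD
  obtain ⟨hΩ, hmesh, -, -, -, hadm⟩ := hΛ
  obtain ⟨η, hη0, hηα, hηβ, hηε⟩ := exists_eta (C₁ := C₁) hα hβ hε
  refine ⟨η, hη0, ?_⟩
  have ev_range : ∀ᶠ δ in 𝓝[>] (0:ℝ), δ ∈ Ioo (0:ℝ) (min η (min (α / 30) (β / 30))) := Ioo_mem_nhdsGT (by positivity)
  filter_upwards [hgoodev, hadm, eventually_two_mul_rpow_le hε, ev_range] with δ hgood hE hsmall hrange Φ Ψ hP f f' hf hf' hdist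
  obtain ⟨hδ, hδlt⟩ := hrange
  have hδη : δ ≤ η := hδlt.le.trans (min_le_left _ _)
  have hδα : δ ≤ α / 30 := hδlt.le.trans ((min_le_right _ _).trans (min_le_left _ _))
  have hδβ : δ ≤ β / 30 := hδlt.le.trans ((min_le_right _ _).trans (min_le_right _ _))
  have hΩδ : (Λ δ).Ω = D.carrier := hΩ δ
  have hmeshδ : (Λ δ).δ = δ := hmesh δ
  -- the box and the depth form of the envelope
  obtain ⟨a, b, a', b', hba6, -, hwid, hwid', hboxT, hdepth⟩ :=
    diamondCollar_box c α β δ hδ (by linarith) (by linarith)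
  have hbox : ∀ x : Site 2, meshPoint δ x ∈ (Λ δ).Ω ↔ (a ≤ x 0 + x 1 ∧ x 0 + x 1 ≤ b ∧ a' ≤ x 1 - x 0 ∧ x 1 - x 0 ≤ b') :=
    fun x => by rw [hΩδ, hcar]; exact hboxT x
  have hconv : Convex ℝ (Λ δ).Ω := by rw [hΩδ, hcar]; exact convex_tiltedBox c _ α β
  have hgood' : ∀ x : Site 2, meshPoint δ x ∈ (Λ δ).Ω → x ∈ meshDomain (Λ δ).Ω δ := by rw [hΩδ]; exact hgood
  -- the lattice depth `m` and the depth form of the envelope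
  obtain ⟨m, hm⟩ : ∃ m : Site 2 → ℤ, ∀ (μ : ℤ) (x : Site 2), μ ≤ m x ↔
      (μ ≤ x 0 + x 1 - a ∧ μ ≤ b - (x 0 + x 1) ∧ μ ≤ x 1 - x 0 - a' ∧ μ ≤ b' - (x 1 - x 0)) :=
    ⟨fun x => min (min (x 0 + x 1 - a) (b - (x 0 + x 1))) (min (x 1 - x 0 - a') (b' - (x 1 - x 0))), fun μ x => by
      simp only [le_min_iff, and_assoc]⟩
  have hobs : ∀ u g : Site 2, IsCorner u g → 2 ≤ m u → ‖cornerObs (Λ δ) δ u g‖ ≤ C₁ * ((m u : ℤ) : ℝ) ^ (-(1:ℝ) / 3) := by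
    intro u g hug hu
    have hmu := (hm (m u) u).1 le_rfl
    have hubox : a ≤ u 0 + u 1 ∧ u 0 + u 1 ≤ b ∧ a' ≤ u 1 - u 0 ∧ u 1 - u 0 ≤ b' := by
      have := (hm 2 u).1 hu; omega
    have key := hobs0 D (Λ δ) hΩδ hE (by rw [hmeshδ]; exact hδ) (m u) u g hug hu
      (by rw [hmeshδ, hcar]; exact hdepth u hubox (m u) hmu)
    rwa [hmeshδ] at key
  -- the lattice scale `N` of `η`
  set N : ℕ := ⌈η / δ⌉₊ + 2 with hN
  have hηδ : δ * (η / δ) = η := by rw [mul_div_assoc', mul_div_cancel_left₀ _ hδ.ne']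
  have hNle : δ * N ≤ η + 3 * δ := by
    have h1 : (N : ℝ) ≤ η / δ + 3 := by
      rw [hN]; push_cast; linarith [Nat.ceil_lt_add_one (by positivity : 0 ≤ η / δ)]
    have := mul_le_mul_of_nonneg_left h1 hδ.le
    rw [mul_add, hηδ] at this
    linarith
  have hNge : η + 2 * δ ≤ δ * N := by
    have h1 : η / δ + 2 ≤ N := by rw [hN]; push_cast; linarith [Nat.le_ceil (η / δ)]
    have := mul_le_mul_of_nonneg_left h1 hδ.le
    rw [mul_add, hηδ] at this
    linarith
  have hsz : 16 * (N : ℤ) + 4 ≤ b - a := box_large hδ hNle hηα hδα hwid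
  have hsz' : 16 * (N : ℤ) + 4 ≤ b' - a' := box_large hδ hNle hηβ hδβ hwid'
  -- interior corners of the two cells
  obtain ⟨hfin, v, hvf, hvA, hvB⟩ := hf
  obtain ⟨hfin', v', hvf', hvA', hvB'⟩ := hf'
  have hframe := diamondArcs_zdBoundary_iff_frame (Λ δ).Ω hconv δ hgood' (Λ δ) rfl hmeshδ a b a' b' hbox hba6
  have interior : ∀ {g w : Site 2}, (Λ δ).IsInnerFace g → IsCorner w g → w ∉ (Λ δ).zdArcA → w ∉ (Λ δ).zdArcB →
      2 ≤ m w := by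
    intro g w hg hwg hwA hwB
    have hwbox := (hbox w).1 (by have := corner_mem_of_isInnerFace hg hwg; rwa [hmeshδ] at this)
    have hwnb : w ∉ (Λ δ).zdBoundary := fun h => (hE.zdBoundary_subset h).elim hwA hwB
    rw [hframe w] at hwnb
    rw [hm]
    omega
  have hv2 := interior hfin hvf hvA hvB
  have hv2' := interior hfin' hvf' hvA' hvB'
  obtain ⟨hc0, hc1⟩ := abs_sub_le_of_dist_ctr hδ hNge hvf hvf' hdist
  -- the chain estimate and the two end increments
  have hwalk := diamondCollar_walk (Λ δ) δ a b a' b' m C₁ Φ Ψ N v v' hconv hmeshδ hgood' hbox hm hC₁ hobs hP hv2 hv2' hc0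
    hc1 hsz hsz'
  have hend : ∀ {g w : Site 2}, (Λ δ).IsInnerFace g → IsCorner w g → w ∉ (Λ δ).zdArcA → w ∉ (Λ δ).zdArcB →
      ‖Φ w - Ψ g‖ ≤ 1 := by
    intro g w hg hwg hwA hwB
    rw [hP w g hwg hg hwA hwB, norm_mul, norm_classWeight_of_isCorner hwg, one_mul]
    exact norm_cornerObs_le_one hE δ hwg
  have e1 := hend hfin hvf hvA hvB
  have e2 := hend hfin' hvf' hvA' hvB'
  have htot : ‖Ψ f - Ψ f'‖ ≤ 2 + 10 * C₁ * (3 * (N : ℝ) + 1) ^ ((2:ℝ) / 3) := by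
    have e : Ψ f - Ψ f' = (Φ v - Φ v') - (Φ v - Ψ f) + (Φ v' - Ψ f') := by ring
    have t1 := norm_add_le ((Φ v - Φ v') - (Φ v - Ψ f)) (Φ v' - Ψ f')
    have t2 := norm_sub_le (Φ v - Φ v') (Φ v - Ψ f)
    rw [e]
    linarith
  -- renormalise
  have hδpow : 0 ≤ δ ^ ((2:ℝ) / 3) := Real.rpow_nonneg hδ.le _
  rw [norm_mul, Complex.norm_real, Real.norm_of_nonneg hδpow]
  have hx : δ * (3 * (N : ℝ) + 1) ≤ 13 * η := by nlinarith
  have hpow : (δ * (3 * (N : ℝ) + 1)) ^ ((2:ℝ) / 3) ≤ (13 * η) ^ ((2:ℝ) / 3) :=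
    Real.rpow_le_rpow (by positivity) hx (by norm_num)
  have hmul : δ ^ ((2:ℝ) / 3) * (3 * (N : ℝ) + 1) ^ ((2:ℝ) / 3) = (δ * (3 * (N : ℝ) + 1)) ^ ((2:ℝ) / 3) :=
    (Real.mul_rpow hδ.le (by positivity)).symm
  calc δ ^ ((2:ℝ) / 3) * ‖Ψ f - Ψ f'‖ ≤ δ ^ ((2:ℝ) / 3) * (2 + 10 * C₁ * (3 * (N : ℝ) + 1) ^ ((2:ℝ) / 3)) :=
        mul_le_mul_of_nonneg_left htot hδpow
    _ = 2 * δ ^ ((2:ℝ) / 3) + 10 * C₁ * (δ ^ ((2:ℝ) / 3) * (3 * (N : ℝ) + 1) ^ ((2:ℝ) / 3)) := by ring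
    _ = 2 * δ ^ ((2:ℝ) / 3) + 10 * C₁ * (δ * (3 * (N : ℝ) + 1)) ^ ((2:ℝ) / 3) := by rw [hmul]
    _ ≤ ε / 2 + 10 * C₁ * (13 * η) ^ ((2:ℝ) / 3) := add_le_add hsmall (mul_le_mul_of_nonneg_left hpow (by positivity))
    _ ≤ ε := by linarith

end Summit.CriticalPhenomena.CardyFormulaZ2.Cruxes.ParafermionToSLESixFamilies.PotentialDarbouxPicardDiamond

end
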